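import Literature.AlgebraicGeometry.Resolution.NearPointColengthDrop
import Literature.AlgebraicGeometry.Resolution.NearPointsRational
import Literature.AlgebraicGeometry.Resolution.GenericPointStalkData
import Mathlib.Algebra.Module.LocalizedModule.Submodule
import Mathlib.Algebra.Module.LocalizedModule.IsLocalization
import Mathlib.RingTheory.Localization.Ideal
import HarnessLib

/-!
# The colength of the weak transform drops at a near point over the generic point of a curve centre

Topic: `Literature/AlgebraicGeometry/Resolution`. [CoP1] = Cossart–Piltant, J. Algebra 320
(2008), proof of Prop. 4.4, p. 10: "Working above the generic point `η(i)` of some one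
dimensional component of `Σ(i)`, we have `J𝒪_{X(i),η(i)}` principal for `i >> 0` (this is a
consequence of [47] appendix 5, theorem 3 and (E) on p. 391); hence `n(i)` eventually drops."
PROVED, the scheme-level statement feeding this termination step: **for the blowing up `π`
of the regular locally Noetherian `X` along a regular centre `Y ⊆ {ord = μ}` and a point `x′`
NEAR its image `η = π x′`, where `η` is the generic point of `Y` (`𝓘_{Y,η} = 𝔪_η`) with
`𝒪_{X,η}` two-dimensional and `J_η` of finite colength, the colength of the weak transform
drops: `λ(𝒪_{X′,x′}/J′_{x′}) < λ(𝒪_{X,η}/J_η)`.** So along the algorithm there is no infinite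
chain of curves of the loci `Σ(i)` each mapping onto the previous one. The local ring
`𝒪_{X′,x′}` is the localization `(B_j)_𝔴` of a chart (`IsBlowup.exists_reesChart_stalk`),
nearness makes `𝔴` near for the forms of `J_η` (`algebraMap_eval₂Hom_mem_pow_of_isNear`),
`NearPointColengthDrop.lean` gives `λ_{B_j}(B_j/J^T) < λ(𝒪_{X,η}/J_η)` for the weak transform
`J^T = (J_η B_j : c_j^μ)`, and `J^T 𝒪_{X′,x′} ⊆ J′_{x′}` with
`λ(𝒪_{X′,x′}/J^T 𝒪_{X′,x′}) ≤ λ_{B_j}(B_j/J^T)` (localization does not increase length).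

* `length_le_of_isLocalizedModule` — `λ_{S}(N) ≤ λ_R(M)` for a localization `N = M_p`;
* `IsBlowup.length_quotient_stalkIdeal_controlledTransform_lt_of_isNear` — **the theorem;**
* `IsBlowup.length_quotient_stalkIdeal_controlledTransform_lt_of_isNear_of_mem_maxPoints` — the
  same with the three local hypotheses discharged from geometry (`GenericPointStalkData.lean`):
  `Y = cl{η}`, `η` a maximal point of `V(J)` of codimension `2`; and
  `length_quotient_stalkIdeal_ne_top_of_mem_maxPoints` — the colength at `η` is finite, so along
  any chain of curves of the loci `Σ(i)` each mapping onto the previous one the natural number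
  `λ(𝒪_{X(i),η(i)}/J(i)_{η(i)})` strictly decreases: such chains are finite.

## Sources

* V. Cossart, O. Piltant, J. Algebra 320 (2008) 1051–1082, proof of Prop. 4.4, p. 10.
  [CossartPiltant2008]
* C. Huneke, I. Swanson, *Integral Closure of Ideals, Rings, and Modules* (2006), Lemma 14.3.4.
  [HunekeSwanson2006]
-/

noncomputable section

open CategoryTheory CategoryTheory.Limits AlgebraicGeometry TopologicalSpace IsLocalRing

namespace Literature.AlgebraicGeometry.Resolution

universe u

open Scheme.IdealSheafData

/-! ## Length does not grow under localization -/

/-- **Localization does not increase length**: if `N` is the localization of the `R`-module `M`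
at `p` (over the localization `S` of `R`), then `λ_S(N) ≤ λ_R(M)` — the `S`-submodules of `N`
embed into the `R`-submodules of `M` by contraction (`Submodule.localized'gi`). [folklore] -/
theorem length_le_of_isLocalizedModule {R S M N : Type*} [CommRing R] [CommRing S]
    [AddCommGroup M] [AddCommGroup N] [Module R M] [Module R N] [Algebra R S] [Module S N]
    [IsScalarTower R S N] (p : Submonoid R) [IsLocalization p S] (f : M →ₗ[R] N)
    [IsLocalizedModule p f] : Module.length S N ≤ Module.length R M := by
  rw [← WithBot.coe_le_coe, Module.coe_length, Module.coe_length]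
  exact Order.krullDim_le_of_strictMono
    (fun N' : Submodule S N => Submodule.comap f (N'.restrictScalars R))
    ((Submodule.localized'gi S p f).gc.monotone_u.strictMono_of_injective
      (Submodule.localized'gi S p f).u_injective)

/-- For a ring homomorphism `χ : B → L` presenting `L` as the localization of `B` at a prime `𝔴`
and an ideal `I` of `B`: `λ_L(L/IL) ≤ λ_B(B/I)`. [folklore] -/
theorem length_quotient_map_le_of_isLocalization {B L : Type*} [CommRing B] [CommRing L]
    [Algebra B L] (𝔴 : Ideal B) [𝔴.IsPrime] [IsLocalization.AtPrime L 𝔴] (I : Ideal B) :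
    Module.length L (L ⧸ I.map (algebraMap B L)) ≤ Module.length B (B ⧸ I) := by
  have h1 : Module.length L (L ⧸ I.map (algebraMap B L)) =
      Module.length (L ⧸ I.map (algebraMap B L)) (L ⧸ I.map (algebraMap B L)) :=
    Module.length_eq_of_surjective (S := L) (R := L ⧸ I.map (algebraMap B L))
      Ideal.Quotient.mk_surjective
  have h2 : Module.length B (B ⧸ I) = Module.length (B ⧸ I) (B ⧸ I) :=
    Module.length_eq_of_surjective (S := B) (R := B ⧸ I) Ideal.Quotient.mk_surjective
  rw [h1, h2]
  exact length_le_of_isLocalizedModule (Algebra.algebraMapSubmonoid (B ⧸ I) 𝔴.primeCompl)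
    (Algebra.linearMap (B ⧸ I) (L ⧸ I.map (algebraMap B L)))

/-! ## The theorem -/

variable {X X' : Scheme.{u}} {π : X' ⟶ X}

set_option maxHeartbeats 400000 in
/-- **[CoP1] Prop. 4.4 ([47] App. 5): at a near point over the generic point of a curve centre
the colength of the weak transform drops.** Let `π` be the blowing up of the regular locally
Noetherian `X` along a regular centre `Y ⊆ {ord = μ}` (`μ ≥ 1`), `x′ ∈ X′` a near point whose
image `η = π x′` has `𝓘_{Y,η} = 𝔪_η` (the generic point of `Y`), `𝒪_{X,η}` of embedding
dimension `2` and `𝒪_{X,η}/J_η` of finite length. Then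
`λ(𝒪_{X′,x′}/J′_{x′}) < λ(𝒪_{X,η}/J_η)` for the weak transform `J′`.
[cite: CossartPiltant2008, proof of Prop. 4.4] [cite: HunekeSwanson2006, Lemma 14.3.4] -/
theorem IsBlowup.length_quotient_stalkIdeal_controlledTransform_lt_of_isNear
    [IsLocallyNoetherian X] [IsLocallyNoetherian X'] {Y : Closeds X}
    (hπ : IsBlowup π (vanishingIdeal Y)) {J : X.IdealSheafData} {μ : ℕ} (hμ : 1 ≤ μ)
    (hY : ∀ y ∈ (Y : Set X), idealOrder J y = μ) {x' : X'}
    [IsRegularLocalRing (X.presheaf.stalk (π x'))]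
    (hη : stalkIdeal (vanishingIdeal Y) (π x') = maximalIdeal (X.presheaf.stalk (π x')))
    (hdim : (maximalIdeal (X.presheaf.stalk (π x'))).spanFinrank = 2)
    (hfin : IsFiniteLength (X.presheaf.stalk (π x'))
      (X.presheaf.stalk (π x') ⧸ stalkIdeal J (π x')))
    (hnear : IsNear π (vanishingIdeal Y) J μ x') :
    Module.length (X'.presheaf.stalk x')
        (X'.presheaf.stalk x' ⧸ stalkIdeal (controlledTransform π (vanishingIdeal Y) J μ) x') <
      Module.length (X.presheaf.stalk (π x')) (X.presheaf.stalk (π x') ⧸ stalkIdeal J (π x')) := by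
  classical
  -- a regular system of parameters `c = (c₀, c₁)` of `𝒪_{X,η}`, generating `𝓘_{Y,η} = 𝔪_η`
  obtain ⟨c, hc⟩ := exists_regularSystemOfParameters (R := X.presheaf.stalk (π x'))
  generalize hd : (maximalIdeal (X.presheaf.stalk (π x'))).spanFinrank = d at c hc
  obtain rfl : d = 2 := hd.symm.trans hdim
  have hcY : Ideal.span (Set.range c) = stalkIdeal (vanishingIdeal Y) (π x') := hc.trans hη.symm
  have hx : π x' ∈ (Y : Set X) := by
    rw [← coe_support_vanishingIdeal, SetLike.mem_coe, mem_support_iff_stalkIdeal_le, hη]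
  -- the chart presentation `𝒪_{X',x'} = (B_j)_𝔴`
  obtain ⟨j, 𝔴, χ, hχ, hloc, h𝔴⟩ := hπ.exists_reesChart_stalk x' c hcY
  have h𝔴' : (maximalIdeal _).map (chartBase c j) ≤ 𝔴.asIdeal := by
    rw [← h𝔴]
    exact Ideal.map_comap_le
  -- `ord_η J = μ`
  have hord := hY (π x') hx
  have hJ : stalkIdeal J (π x') ≤ maximalIdeal _ ^ μ := (le_idealOrder_iff J (π x') μ).mp hord.ge
  have hJ' : ¬ stalkIdeal J (π x') ≤ maximalIdeal _ ^ (μ + 1) := by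
    rw [← le_idealOrder_iff, hord]
    exact_mod_cast Nat.not_succ_le_self μ
  -- nearness read on the chart, and the ring-level colength drop for `J^T = (J_η B_j : c_j^μ)`
  have hnearF := fun (F : MvPolynomial (Fin 2) (X.presheaf.stalk (π x'))) (hF : F.IsHomogeneous μ)
      (hFJ : MvPolynomial.eval c F ∈ stalkIdeal J (π x')) =>
    algebraMap_eval₂Hom_mem_pow_of_isNear hcY j 𝔴 χ hχ hloc hnear hF hFJ
  have hlt := length_quotient_weakTransform_lt_of_near hd c hc j hμ hJ hJ' hfin 𝔴.asIdeal h𝔴'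
    hnearF
  -- `J^T 𝒪_{X',x'} ⊆ J'_{x'}`
  letI := χ.toAlgebra
  haveI : IsLocalization.AtPrime (X'.presheaf.stalk x') 𝔴.asIdeal := hloc
  obtain ⟨JT, hJT⟩ : ∃ JT : Ideal (chartRing c j),
      JT = ((stalkIdeal J (π x')).map (chartBase c j)).colon {chartBase c j (c j) ^ μ} := ⟨_, rfl⟩
  rw [← hJT] at hlt
  have hu : ∀ i, (π.stalkMap x').hom (c i) = (π.stalkMap x').hom (c j) * χ (chartGen c j i) :=
    fun i => by rw [← hχ, ← hχ, ← map_mul, ← reesChartBase_apply_eq_mul_chartGen c j i]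
  have hCmap : (stalkIdeal (vanishingIdeal Y) (π x')).map (π.stalkMap x').hom =
      Ideal.span {χ (chartBase c j (c j))} := by
    rw [← hcY, Ideal.map_span_range_eq_span_singleton _ c j _ hu, ← hχ]
  have hJmap : ((stalkIdeal J (π x')).map (chartBase c j)).map χ =
      (stalkIdeal J (π x')).map (π.stalkMap x').hom := by
    rw [Ideal.map_map]
    congr 1
    exact RingHom.ext hχ
  have hle : JT.map χ ≤ stalkIdeal (controlledTransform π (vanishingIdeal Y) J μ) x' := by
    rw [controlledTransform, stalkIdeal_colon, stalkIdeal_pow, stalkIdeal_comap_eq_map_stalkMap,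
      stalkIdeal_comap_eq_map_stalkMap, hCmap, Ideal.map_le_iff_le_comap]
    intro b hb
    rw [Ideal.mem_comap, Submodule.mem_colon]
    intro p hp
    rw [Ideal.span_singleton_pow, SetLike.mem_coe] at hp
    obtain ⟨r, rfl⟩ := Ideal.mem_span_singleton'.mp hp
    have hb' : b * chartBase c j (c j) ^ μ ∈ (stalkIdeal J (π x')).map (chartBase c j) := by
      rw [hJT] at hb
      have := Submodule.mem_colon_singleton.mp hb
      rwa [smul_eq_mul] at this
    rw [smul_eq_mul, ← hJmap, mul_left_comm, ← map_pow, ← map_mul]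
    exact Ideal.mul_mem_left _ r (Ideal.mem_map_of_mem χ hb')
  -- lengths: `λ_L(L/J') ≤ λ_L(L/J^T L) ≤ λ_B(B/J^T) < λ_R(R/J_η)`
  have h1 : Module.length (X'.presheaf.stalk x')
        (X'.presheaf.stalk x' ⧸ stalkIdeal (controlledTransform π (vanishingIdeal Y) J μ) x') ≤
      Module.length (X'.presheaf.stalk x') (X'.presheaf.stalk x' ⧸ JT.map χ) :=
    Module.length_le_of_surjective (Submodule.factor hle) (Submodule.factor_surjective hle)
  have h2 : Module.length (X'.presheaf.stalk x') (X'.presheaf.stalk x' ⧸ JT.map χ) ≤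
      Module.length (chartRing c j) (chartRing c j ⧸ JT) :=
    length_quotient_map_le_of_isLocalization (L := X'.presheaf.stalk x') 𝔴.asIdeal JT
  exact h1.trans_lt (h2.trans_lt hlt)

/-- **[CoP1] Prop. 4.4: above the generic point of a curve of `V(J)` the colength of the weak
transform drops at a near point** — geometric form: `Y = cl{η}` a regular centre inside
`{ord = μ}` whose generic point `η` is a maximal point of `V(J)` of codimension `2` (a curve of
`V(J)` on a threefold), `x′` a near point over `η`. [cite: CossartPiltant2008, proof of Prop. 4.4] -/
theorem IsBlowup.length_quotient_stalkIdeal_controlledTransform_lt_of_isNear_of_mem_maxPoints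
    [IsLocallyNoetherian X] [IsLocallyNoetherian X'] {Y : Closeds X}
    (hπ : IsBlowup π (vanishingIdeal Y)) {J : X.IdealSheafData} {μ : ℕ} (hμ : 1 ≤ μ)
    (hY : ∀ y ∈ (Y : Set X), idealOrder J y = μ) {x' : X'}
    [IsRegularLocalRing (X.presheaf.stalk (π x'))]
    (hYη : (Y : Set X) = closure {π x'}) (hmax : π x' ∈ maxPoints (J.support : Set X))
    (hcodim : Order.coheight (π x') = 2) (hnear : IsNear π (vanishingIdeal Y) J μ x') :
    Module.length (X'.presheaf.stalk x')
        (X'.presheaf.stalk x' ⧸ stalkIdeal (controlledTransform π (vanishingIdeal Y) J μ) x') <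
      Module.length (X.presheaf.stalk (π x')) (X.presheaf.stalk (π x') ⧸ stalkIdeal J (π x')) :=
  hπ.length_quotient_stalkIdeal_controlledTransform_lt_of_isNear hμ hY
    (stalkIdeal_vanishingIdeal_eq_maximalIdeal_of_closure_eq hYη)
    (spanFinrank_maximalIdeal_stalk_eq (π x') hcodim)
    (isFiniteLength_quotient_stalkIdeal_of_mem_maxPoints hmax) hnear

/-- The colength at a maximal point of `V(J)` is finite (`GenericPointStalkData.lean`), so the
inequality above is one of natural numbers. [cite: CossartPiltant2008, proof of Prop. 4.4] -/
theorem length_quotient_stalkIdeal_ne_top_of_mem_maxPoints [IsLocallyNoetherian X]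
    {J : X.IdealSheafData} {η : X} (hmax : η ∈ maxPoints (J.support : Set X)) :
    Module.length (X.presheaf.stalk η) (X.presheaf.stalk η ⧸ stalkIdeal J η) ≠ ⊤ :=
  Module.length_ne_top_iff.mpr (isFiniteLength_quotient_stalkIdeal_of_mem_maxPoints hmax)

end Literature.AlgebraicGeometry.Resolution

end
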